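import Summits.ResolutionOfSingularities.ResolutionOfSingularities.Theorems.FrobeniusClosingSteerNoEternalChainCore
import Literature.AlgebraicGeometry.Resolution.QuadraticTransforms
import Literature.RingTheory.RegularLocalRing.QuotientDVR
import HarnessLib

/-!
# Crux `Steer` (stmt-ResolutionOfSingularities-16345), chain W4.1, R2 σ_top line: **K(1)** —
# no eternal isolated radicand chain in codimension one (Theses-free body; assembly)

OURS (campaign `res-hironaka`, rung L ★L-G4, slot W4.1, chain W4.1, seat `res-L0-w41-stub-7` = `res-D-pv-011`;
replaces the role of no printed item; NOT a statement of the manuscript under review; AI review is weaker than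
expert review). This file PROVES the support piece **K(1) = `∀ p prime, NoEternalIsolatedRadicandChain p 1`** of
the planner's typed sub-plan `L/w41/Sketch-R2-steered.lean` (res-L0-w41-plan-1 g5, sha16 fb4f9514a6cb98fe, §3.1 —
idea-1's `NoEternalIsolatedRadicandChain` VERBATIM, the case `c = 1`; card `L/w41/CRUX-PLAN-Steer-v3-R2.md`, row K(1)),
with `HasIsolatedSingularity` / `RadicandRing` unfolded, so that the by-name leaf for the composition
`core4EternalNonIsolated_of`'s input `hK1` is

  `fun p hp => NoEternalChainOne.noEternalIsolatedRadicandChain_one p hp`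

(kernel-checked against a HOME copy of the sketch before filing). The single-ring core
(`NoEternalChainOne.false_of_frobeniusChain`: excellent local domain of characteristic `p`, reduced case by
`IsExcellentRing.isReduced_adicCompletion` and the non-zero nilpotent `lim (T − c n)`, non-reduced case by isolatedness
at a non-maximal prime containing an annihilator) is `FrobeniusClosingSteerNoEternalChainCore.lean`; here:

* `NoEternalChainOne.eq_of_isQuadraticTransform_of_span_singleton` — a quadratic transform (Cutkosky §2.1) of a local
  subring with PRINCIPAL maximal ideal `(π)` is the ring itself: along `0 ≠ x = r π ∈ 𝔪`, `r⁻¹ = π / x ∈ R[𝔪/x] ⊆ R₁`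
  lies in `R` by domination, so `𝔪 = (x)`, `R[𝔪/x] = R`, and `R₁ = R`;
* `NoEternalChainOne.inclusion_mem_maximalIdeal_of_subringDominates` — non-units stay non-units along domination;
* `NoEternalChainOne.noEternalIsolatedRadicandChain_one` — K(1): the members are regular local of dimension one, i.e.
  discrete valuation rings (`isDiscreteValuationRing_of_ringKrullDim_eq_one`), so the chain lives in `S 0`, the
  exceptional parameters lie in `𝔪_{S 0}`, and the core applies at stage `0` (the multiplicity hypothesis is not used).
[cite: Cutkosky2014, §2.1] [cite: StacksProject, Tag 07QK] [folklore]
-/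

noncomputable section

-- `Summit.<S>.<S>.…` duplicates the summit name by design (single-problem summit).
set_option linter.dupNamespace false

open Polynomial IsLocalRing

namespace Summit.ResolutionOfSingularities.ResolutionOfSingularities.Theorems.SwitchingDichotomy

open Literature.AlgebraicGeometry.Resolution

namespace NoEternalChainOne

universe u

/-! ## (3) Quadratic transforms of local subrings with principal maximal ideal are trivial -/

section Quadratic

variable {L : Type u} [Field L]

/-- **A quadratic transform of a local subring with principal maximal ideal is the ring itself** (Cutkosky §2.1 for
a discrete valuation ring): if `𝔪_R = (π)` and `R → R₁` is a quadratic transform along `0 ≠ x ∈ 𝔪_R`, then `x = r π`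
with `r⁻¹ = π / x ∈ R[𝔪/x] ⊆ R₁`, so `r` is a unit of `R` by domination, `𝔪_R = (x)`, `R[𝔪/x] = R`, and every
`a / b ∈ R₁` (`a, b ∈ R`, `b⁻¹ ∈ R₁`) lies in `R`. [cite: Cutkosky2014, §2.1] [folklore] -/
theorem eq_of_isQuadraticTransform_of_span_singleton {R R₁ : Subring L} [IsLocalRing R] (π : R)
    (hπ : maximalIdeal R = Ideal.span {π}) (h : IsQuadraticTransform R R₁) : R₁ = R := by
  obtain ⟨_, x, hx, hx0, _, hbl, hfrac, hdom⟩ := h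
  -- `x = r π`, and `r⁻¹ = π / x ∈ R₁`, hence `r⁻¹ ∈ R`
  rw [hπ, Ideal.mem_span_singleton'] at hx
  obtain ⟨r, hrx⟩ := hx
  have hx0' : (x : L) ≠ 0 := fun e => hx0 (Subtype.ext e)
  have hr0 : (r : L) ≠ 0 := by
    intro e
    apply hx0'
    rw [← hrx, Subring.coe_mul, e, zero_mul]
  have hπ0 : (π : L) ≠ 0 := by
    intro e
    apply hx0'
    rw [← hrx, Subring.coe_mul, e, mul_zero]
  have hπmem : π ∈ maximalIdeal R := by rw [hπ]; exact Ideal.mem_span_singleton_self π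
  have hdiv : (π : L) / x ∈ R₁ := hbl (div_mem_blowupRing (x : L) hπmem)
  have hrinv : ((r : L))⁻¹ ∈ R := by
    refine hdom.2 _ r.2 ?_
    have : (π : L) / x = ((r : L))⁻¹ := by
      rw [← hrx, Subring.coe_mul]
      field_simp
    rw [← this]
    exact hdiv
  have hru : IsUnit r := (isUnit_subring_iff_inv_mem r).mpr ⟨hr0, hrinv⟩
  -- `𝔪_R = (x)`, so `R[𝔪/x] = R`
  have hmx : maximalIdeal R = Ideal.span {x} := by rw [hπ, ← hrx, Ideal.span_singleton_mul_left_unit hru]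
  have hblR : blowupRing R (x : L) ≤ R := by
    refine Subring.closure_le.mpr ?_
    rintro z (hz | ⟨y, hy, rfl⟩)
    · exact hz
    · have hy' : y ∈ Ideal.span {x} := by rw [← hmx]; exact hy
      obtain ⟨s, hs⟩ := Ideal.mem_span_singleton'.mp hy'
      have : ((y : R) : L) / x = s := by
        rw [← hs, Subring.coe_mul, mul_div_assoc, div_self hx0', mul_one]
      show ((y : R) : L) / x ∈ R
      rw [this]
      exact s.2
  -- every element of `R₁` is `a / b` with `a, b ∈ R`, `b⁻¹ ∈ R₁`, hence `b⁻¹ ∈ R`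
  refine le_antisymm (fun z hz => ?_) hdom.1
  obtain ⟨a, ha, b, hb, hbinv, rfl⟩ := hfrac z hz
  rw [div_eq_mul_inv]
  exact R.mul_mem (hblR ha) (hdom.2 b (hblR hb) hbinv)

/-- Along a dominated extension of local subrings, non-units stay non-units: the maximal ideal maps into the
maximal ideal. [cite: Cutkosky2014, §2.1] [folklore] -/
theorem inclusion_mem_maximalIdeal_of_subringDominates {R R₁ : Subring L} [IsLocalRing R] [IsLocalRing R₁]
    (hdom : SubringDominates R R₁) {y : R} (hy : y ∈ maximalIdeal R) :
    (⟨(y : L), hdom.1 y.2⟩ : R₁) ∈ maximalIdeal R₁ := by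
  rw [mem_maximalIdeal_iff_inv_not_mem] at hy ⊢
  rcases hy with hy | hy
  · exact Or.inl hy
  · exact Or.inr fun h => hy (hdom.2 _ y.2 h)

end Quadratic

/-! ## (4) K(1): no eternal isolated radicand chain in codimension one -/

/-- **K(1) — `NoEternalIsolatedRadicandChain p 1`** (idea-1's statement, `L/w41/Sketch-R2-steered.lean` §3.1, VERBATIM
with `c = 1` and `HasIsolatedSingularity` / `RadicandRing` unfolded): there is no infinite sequence of quadratic
transforms of excellent regular local rings of dimension ONE inside a field of characteristic `p`, carrying radicands
`f m` with `f (m+1) · (x m)^p = f m − (g m)^p` (`x m` the exceptional parameter), of multiplicity `p` after cleaning,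
with isolated torsor singularity at every stage. Proof: the members are discrete valuation rings, so every quadratic
transform is the identity (`eq_of_isQuadraticTransform_of_span_singleton`), the chain lives in `S 0`, and
`false_of_frobeniusChain` applies at stage `0` (only the isolatedness at stage `0`, the relations, `x m ∈ 𝔪` and the
excellence / regularity / dimension of the members are used; the multiplicity hypothesis is not).
[cite: StacksProject, Tag 07QK] [cite: Cutkosky2014, §2.1] [folklore] -/
theorem noEternalIsolatedRadicandChain_one (p : ℕ) (hp : p.Prime) :
    ∀ (L : Type) [Field L] [CharP L p] (S : ℕ → Subring L) [∀ m, IsLocalRing (S m)]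
      (hle : ∀ m, S m ≤ S (m + 1)) (f g : ∀ m, S m) (x : ∀ m, S (m + 1)),
      (∀ m, IsRegularLocalRing (S m)) → (∀ m, IsExcellentRing (S m)) → (∀ m, ringKrullDim (S m) = (1 : ℕ)) →
      (∀ m, IsQuadraticTransform (S m) (S (m + 1))) →
      (∀ m, Ideal.span ((fun y : S m => (⟨(y : L), hle m y.2⟩ : S (m + 1))) ''
          (maximalIdeal (S m) : Set (S m))) = Ideal.span {x m}) →
      (∀ m, ((f (m + 1) : S (m + 1)) : L) * ((x m : S (m + 1)) : L) ^ p =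
          ((f m : S m) : L) - ((g m : S m) : L) ^ p) →
      (∀ m, ∃ h : S m, f m - h ^ p ∈ maximalIdeal (S m) ^ p) →
      (∀ m, ∀ (P : Ideal (AdjoinRoot ((X : (S m)[X]) ^ p - C (f m)))) [P.IsPrime],
          (∃ Q : Ideal (AdjoinRoot ((X : (S m)[X]) ^ p - C (f m))), Q.IsPrime ∧ P < Q) →
          IsRegularLocalRing (Localization.AtPrime P)) →
      False := by
  intro L _ _ S _ hle f g x hreg hexc hdim hQT hspan hrel _ hisol
  haveI := Fact.mk hp
  -- ### the members are discrete valuation rings, so the chain lives in `S 0`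
  have hdim' : ∀ m, ringKrullDim (S m) = 1 := fun m => by rw [hdim m, Nat.cast_one]
  have hDVR : ∀ m, IsDiscreteValuationRing (S m) := fun m =>
    haveI := hreg m
    Literature.RingTheory.RegularLocalRing.isDiscreteValuationRing_of_ringKrullDim_eq_one (hdim' m)
  have hstep : ∀ m, S (m + 1) = S m := fun m => by
    haveI := hDVR m
    obtain ⟨ϖ, hϖ⟩ := IsDiscreteValuationRing.exists_irreducible (S m)
    exact eq_of_isQuadraticTransform_of_span_singleton ϖ hϖ.maximalIdeal_eq (hQT m)
  have hSeq : ∀ m, S m = S 0 := fun m => by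
    induction m with
    | zero => rfl
    | succ m ih => rw [hstep m, ih]
  -- ### transport of the chain into `S 0`
  let f' : ℕ → S 0 := fun m => ⟨(f m : L), by rw [← hSeq m]; exact (f m).2⟩
  let g' : ℕ → S 0 := fun m => ⟨(g m : L), by rw [← hSeq m]; exact (g m).2⟩
  let x' : ℕ → S 0 := fun m => ⟨(x m : L), by rw [← hSeq (m + 1)]; exact (x m).2⟩
  have hxmax : ∀ m, x m ∈ maximalIdeal (S (m + 1)) := fun m => by
    have hxs : x m ∈ Ideal.span {x m} := Ideal.mem_span_singleton_self _
    rw [← hspan m] at hxs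
    refine (Ideal.span_le.mpr ?_) hxs
    rintro _ ⟨y, hy, rfl⟩
    exact inclusion_mem_maximalIdeal_of_subringDominates (hQT m).dominates hy
  have hx' : ∀ m, x' m ∈ maximalIdeal (S 0) := fun m => by
    have h := hxmax m
    rw [mem_maximalIdeal_iff_inv_not_mem] at h ⊢
    rcases h with h | h
    · exact Or.inl h
    · right
      show ((x m : S (m + 1)) : L)⁻¹ ∉ S 0
      rw [← hSeq (m + 1)]
      exact h
  have hrel' : ∀ m, f' (m + 1) * x' m ^ p = f' m - g' m ^ p := fun m => by
    apply Subtype.ext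
    show ((f (m + 1) : S (m + 1)) : L) * ((x m : S (m + 1)) : L) ^ p = ((f m : S m) : L) - ((g m : S m) : L) ^ p
    exact hrel m
  -- ### the core at stage `0`
  haveI := hreg 0
  have hS : maximalIdeal (S 0) ≠ ⊥ := by
    haveI := hDVR 0
    exact IsDiscreteValuationRing.not_a_field (S 0)
  have hf0 : f' 0 = f 0 := Subtype.ext rfl
  refine false_of_frobeniusChain p hS (hexc 0) f' g' x' hx' hrel' ?_
  rw [hf0]
  exact hisol 0

end NoEternalChainOne

end Summit.ResolutionOfSingularities.ResolutionOfSingularities.Theorems.SwitchingDichotomy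

end
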